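import Literature.NumberTheory.EllipticCurves.IntSeriesIdentityPrinciple
import Mathlib.NumberTheory.Padics.RingHoms
import Mathlib.Analysis.SpecificLimits.Basic
import HarnessLib

/-!
# STUB-IDEAS k3·g7 — `stub_heegnerIndexLowerAtTwo` (crux `SplitBadTwoLowerHalfOfFacts`, item
# stmt-BirchSwinnertonDyer-27851): DECOMPOSITION of H_B (k1-g6's research input «odd-coset CM-value
# continuity at 2», the `limS` field of `OddCosetWitness`) into sub-stubs with a PROVED glue.

TECHNIQUE (director): decomposition (split into sub-stubs with a provable glue).  Node: STUB-PLAN v1.8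
«HARDEST NOW := T3(H_W-table ∧ H_B at 2) ∧ R2c-iv′», price P-HB «odd-coset CM-value continuity at 2 for
ORDINARY test objects with CM by `𝒪_{2^{n_v}c₀}` over a ramified base: research-S/M (q-expansion
principle in Katz's ring V any p ✓; canonical-subgroup/Serre–Tate bookkeeping at 2 unprinted)».

THE SPLIT.  H_B(limit) `S n → S⋆` is cut into
* HB1 (odd-coset q-expansion convergence — ELEMENTARY, PROVED here §1–§2): for every bounded coefficient
  function `g` the coefficient functions of `θ^{2^{n+1}−1} g` converge UNIFORMLY in `m` to those of
  `θ^{−1} g^♭` (`g^♭` = 2-depletion) at rate `2^{−(n+1)}`: odd `m`: `m^{2^{n+1}} ≡ 1 (mod 2^{n+2})`;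
  even `m`: `‖m^{2^{n+1}−1}‖ ≤ 2^{−(2^{n+1}−1)}` — depletion EMERGES in the limit, it is never evaluated;
* HB2 (PRINT, every `p`, incl. 2): evaluation of Katz's ring `V(N₀) ⊗̂ 𝒪_{ℂ₂}` at a trivialised ordinary
  test object over `𝒪_{ℂ₂}` is a contraction for the coefficientwise sup-distance of q-expansions
  (q-expansion principle for every `W`-algebra `A` ⟹ saturation; evaluation = base change) — typed as
  the interface `IsQExpContraction` (§3); NO Serre–Tate coordinate, NO canonical subgroup, NO measure:
  a SEQUENTIAL limit at a FIXED test object, so «over a ramified base» is harmless;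
* HB2′ (weights converge — ELEMENTARY, PROVED §2/§4): `N𝔞^{1−2^{n+1}} → N𝔞⁻¹·…`, `Λ(𝔞)^{2^{n+1}} → 1`
  for 2-adic units (`K₀,v = ℚ₂`): the SAME congruence as HB1;
* HB3 (in-range comparison, PRINT-shape every `p`): Katz's «unit-root splitting = CM splitting» at
  ordinary CM test objects of ANY conductor, for the UNDEPLETED `θ^j f₀`, `j ≥ 0` (in range) — so the
  depletion/`V`-bookkeeping at CM points of conductor `c₀2^{n_v}` is EXPELLED from H_B (it lives in
  H_C only, where §5's Lemma V + k3-g5's PROVED orthogonality tables discharge it at `p = 2`).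
GLUE (PROVED, §3–§4): contraction ∘ uniform convergence ∘ finite character sum ⟹
`CMEvaluationData.limS : Tendsto S atTop (𝓝 Sstar)` — literally the type of k1-g6's field `limS`.
§5: Lemma V (canonical subgroup of a CM curve of conductor `c2^{n}`, `n ≥ 1`, `2` split = kernel of
the UP-isogeny) as a kernel-checked LATTICE computation in `ℤ² ≅ 𝒪_{K₀} ⊗ ℤ₍₂₎`-coordinates.

No `sorry`, no `instance`, no notation, no `∃`-frame.  BSD is NOT proved by any of this; neither is
H_B for the actual CM data (HB2/HB3 are interfaces to printed theorems), the stub, T3, or the crux.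
-/

noncomputable section

open Filter Topology

namespace Summit.BirchSwinnertonDyer.BirchSwinnertonDyer.Cruxes.SplitBadTwoLowerHalfOfFacts.HeegnerIndexTwo.K3G7

/-! ### §1. The odd-coset congruence (any commutative ring; PROVED) -/

/-- One squaring step: `2^{k+1} ∣ y − 1 ⟹ 2^{k+2} ∣ y² − 1`. -/
theorem sq_sub_one_dvd_step {R : Type*} [CommRing R] {y : R} {k : ℕ}
    (h : (2 : R) ^ (k + 1) ∣ y - 1) : (2 : R) ^ (k + 2) ∣ y ^ 2 - 1 := by
  obtain ⟨t, ht⟩ := h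
  refine ⟨t * ((2 : R) ^ k * t + 1), ?_⟩
  have hy : y = (2 : R) ^ (k + 1) * t + 1 := by linear_combination ht
  rw [hy]; ring

/-- **HB1/HB2′ core.** In any commutative ring: `2 ∣ x − 1 ⟹ 2^{n+1} ∣ x^{2^n} − 1`. -/
theorem two_pow_succ_dvd_pow_two_pow_sub_one {R : Type*} [CommRing R] {x : R}
    (h : (2 : R) ∣ x - 1) (n : ℕ) : (2 : R) ^ (n + 1) ∣ x ^ (2 ^ n) - 1 := by
  induction n with
  | zero => simpa using h
  | succ n ih =>
    have hx : x ^ (2 ^ (n + 1)) = (x ^ (2 ^ n)) ^ 2 := by rw [pow_succ, pow_mul]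
    rw [hx]
    exact sq_sub_one_dvd_step ih

/-- Sharp base for odd integers: `8 ∣ m² − 1`. -/
theorem eight_dvd_sq_sub_one_of_odd {m : ℤ} (hm : Odd m) : (2 : ℤ) ^ 3 ∣ m ^ 2 - 1 := by
  obtain ⟨k, rfl⟩ := hm
  obtain ⟨r, hr⟩ := Int.even_mul_succ_self k
  exact ⟨r, by linear_combination 4 * hr⟩

/-- Sharp odd-integer congruence: `m^{2^{n+1}} ≡ 1 (mod 2^{n+3})` (the classical `v₂(m^{2^k} − 1) ≥ k + 2`). -/
theorem two_pow_add_three_dvd_of_odd {m : ℤ} (hm : Odd m) (n : ℕ) :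
    (2 : ℤ) ^ (n + 3) ∣ m ^ (2 ^ (n + 1)) - 1 := by
  induction n with
  | zero => simpa using eight_dvd_sq_sub_one_of_odd hm
  | succ n ih =>
    have hx : m ^ (2 ^ (n + 2)) = (m ^ (2 ^ (n + 1))) ^ 2 := by rw [pow_succ, pow_mul]
    rw [hx]
    exact sq_sub_one_dvd_step ih

/-! ### §2. 2-adic norms (PROVED) -/

/-- Odd naturals are 2-adic units. -/
theorem norm_natCast_eq_one_of_odd {m : ℕ} (hm : Odd m) : ‖(m : ℚ_[2])‖ = 1 := by
  rw [Padic.norm_natCast_eq_one_iff]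
  exact Nat.coprime_two_left.mpr hm

theorem norm_pow_two_pow_sub_one_le {m : ℕ} (hm : Odd m) (n : ℕ) :
    ‖(m : ℚ_[2]) ^ (2 ^ n) - 1‖ ≤ (2 : ℝ) ^ (-((n + 1 : ℕ) : ℤ)) := by
  have h2 : (2 : ℤ) ∣ (m : ℤ) - 1 := by
    obtain ⟨k, hk⟩ := hm
    exact ⟨k, by omega⟩
  have hdvd := two_pow_succ_dvd_pow_two_pow_sub_one h2 n
  have key := (Padic.norm_int_le_pow_iff_dvd (p := 2) ((m : ℤ) ^ (2 ^ n) - 1) (n + 1)).2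
    (by exact_mod_cast hdvd)
  have hc : (((m : ℤ) ^ (2 ^ n) - 1 : ℤ) : ℚ_[2]) = (m : ℚ_[2]) ^ (2 ^ n) - 1 := by push_cast; rfl
  rw [hc] at key
  exact_mod_cast key

/-- **HB1, odd index.** `‖m^{2^n − 1} − m⁻¹‖₂ ≤ 2^{−(n+1)}` for odd `m`. -/
theorem norm_pow_sub_inv_le {m : ℕ} (hm : Odd m) (n : ℕ) :
    ‖(m : ℚ_[2]) ^ (2 ^ n - 1) - (m : ℚ_[2])⁻¹‖ ≤ (2 : ℝ) ^ (-((n + 1 : ℕ) : ℤ)) := by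
  have hm0 : (m : ℚ_[2]) ≠ 0 := by
    intro h
    have := norm_natCast_eq_one_of_odd hm
    rw [h, norm_zero] at this
    exact zero_ne_one this
  have h1 : (m : ℚ_[2]) ^ (2 ^ n) = (m : ℚ_[2]) ^ (2 ^ n - 1) * m := by
    rw [← pow_succ, Nat.sub_add_cancel Nat.one_le_two_pow]
  have key : (m : ℚ_[2]) ^ (2 ^ n - 1) - (m : ℚ_[2])⁻¹ =
      (m : ℚ_[2])⁻¹ * ((m : ℚ_[2]) ^ (2 ^ n) - 1) := by
    rw [h1]; field_simp
  rw [key, norm_mul, norm_inv, norm_natCast_eq_one_of_odd hm, inv_one, one_mul]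
  exact norm_pow_two_pow_sub_one_le hm n

theorem norm_two : ‖(2 : ℚ_[2])‖ = 2⁻¹ := by
  simpa using Padic.norm_p (p := 2)

/-- **HB1, even index.** `‖m^j‖₂ ≤ 2^{−j}` for even `m`. -/
theorem norm_pow_le_of_even {m : ℕ} (hm : Even m) (j : ℕ) :
    ‖(m : ℚ_[2]) ^ j‖ ≤ (2 : ℝ) ^ (-(j : ℤ)) := by
  obtain ⟨k, rfl⟩ := hm
  have hk : ((k + k : ℕ) : ℚ_[2]) = 2 * (k : ℚ_[2]) := by push_cast; ring
  have hk1 : ‖(k : ℚ_[2])‖ ≤ 1 := by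
    simpa using Padic.norm_int_le_one (p := 2) (k : ℤ)
  rw [hk, mul_pow, norm_mul, norm_pow, norm_pow, norm_two, zpow_neg, zpow_natCast, ← inv_pow]
  exact mul_le_of_le_one_right (by positivity) (pow_le_one₀ (norm_nonneg _) hk1)

/-- HB2′ for 2-adic UNITS (values `Λ(𝔞) = α/ᾱ ∈ ℤ₂^×`, `K₀,v = ℚ₂`): every unit of `ℤ₂` is principal
(residue field `𝔽₂`) … -/
theorem two_dvd_sub_one_of_isUnit {u : ℤ_[2]} (hu : IsUnit u) : (2 : ℤ_[2]) ∣ u - 1 := by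
  have h01 : ∀ a : ZMod 2, a = 0 ∨ a = 1 := by decide
  have hu' : IsUnit (PadicInt.toZMod u) := hu.map _
  have h1 : PadicInt.toZMod u = 1 := by
    rcases h01 (PadicInt.toZMod u) with h | h
    · exact absurd h hu'.ne_zero
    · exact h
  have hker : u - 1 ∈ RingHom.ker (PadicInt.toZMod : ℤ_[2] →+* ZMod 2) := by
    rw [RingHom.mem_ker, map_sub, h1, map_one, sub_self]
  rw [PadicInt.ker_toZMod, PadicInt.maximalIdeal_eq_span_p, Ideal.mem_span_singleton] at hker
  simpa using hker

/-- … hence `‖u^{2^n} − 1‖ ≤ 2^{−(n+1)} → 0`. -/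
theorem norm_unit_pow_two_pow_sub_one_le {u : ℤ_[2]} (hu : IsUnit u) (n : ℕ) :
    ‖u ^ (2 ^ n) - 1‖ ≤ (2 : ℝ) ^ (-((n + 1 : ℕ) : ℤ)) := by
  have hdvd := two_pow_succ_dvd_pow_two_pow_sub_one (two_dvd_sub_one_of_isUnit hu) n
  have := (PadicInt.norm_le_pow_iff_mem_span_pow (u ^ (2 ^ n) - 1) (n + 1)).2
    (Ideal.mem_span_singleton.2 (by simpa using hdvd))
  exact_mod_cast this

/-! ### §3. HB1 in the value field and the glue (PROVED)

`L` = any complete normed field over `ℚ₂` (the card: `L = ℂ₂`, instance checked at the end of §4). -/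

variable {L : Type*} [NormedField L] [NormedAlgebra ℚ_[2] L]

/-- coefficient function of `θ^j g`: `m ↦ m^j · g(m)`. -/
def thetaPow (j : ℕ) (g : ℕ → L) : ℕ → L := fun m => (m : L) ^ j * g m

/-- coefficient function of `θ^{−1} g^♭` (`g^♭` the 2-depletion): `m ↦ [m odd]·m⁻¹·g(m)`. -/
def thetaInvDepl (g : ℕ → L) : ℕ → L := fun m => if Odd m then (m : L)⁻¹ * g m else 0

/-- the 2-depletion `g^♭`. -/
def depl (g : ℕ → L) : ℕ → L := fun m => if Odd m then g m else 0

theorem norm_natCast_algebra (m : ℕ) : ‖(m : L)‖ = ‖(m : ℚ_[2])‖ := by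
  rw [← map_natCast (algebraMap ℚ_[2] L) m, norm_algebraMap']

theorem two_zpow_antitone {a b : ℤ} (h : a ≤ b) : (2 : ℝ) ^ (-b) ≤ (2 : ℝ) ^ (-a) :=
  zpow_le_zpow_right₀ (by norm_num) (neg_le_neg h)

/-- **HB1 (PROVED): odd-coset q-expansion convergence, uniform in the index.** For `‖g‖ ≤ 1`:
`‖θ^{2^{n+1}−1} g (m) − θ^{−1} g^♭ (m)‖ ≤ 2^{−(n+1)}` for every `m`. -/
theorem norm_thetaPow_sub_thetaInvDepl_le (g : ℕ → L) (hg : ∀ m, ‖g m‖ ≤ 1) (n m : ℕ) :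
    ‖thetaPow (2 ^ (n + 1) - 1) g m - thetaInvDepl g m‖ ≤ (2 : ℝ) ^ (-((n + 1 : ℕ) : ℤ)) := by
  unfold thetaPow thetaInvDepl
  rcases Nat.even_or_odd m with hm | hm
  · -- even index: the depleted limit coefficient is 0 and `‖m^j‖ ≤ 2^{-j} ≤ 2^{-(n+1)}`
    rw [if_neg (Nat.not_odd_iff_even.mpr hm), sub_zero, norm_mul]
    have hj : ‖(m : L) ^ (2 ^ (n + 1) - 1)‖ ≤ (2 : ℝ) ^ (-((2 ^ (n + 1) - 1 : ℕ) : ℤ)) := by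
      rw [norm_pow, norm_natCast_algebra, ← norm_pow]
      exact norm_pow_le_of_even hm _
    have hle : ((n + 1 : ℕ) : ℤ) ≤ ((2 ^ (n + 1) - 1 : ℕ) : ℤ) := by
      have : n + 1 < 2 ^ (n + 1) := Nat.lt_two_pow_self
      omega
    calc ‖(m : L) ^ (2 ^ (n + 1) - 1)‖ * ‖g m‖
        ≤ (2 : ℝ) ^ (-((2 ^ (n + 1) - 1 : ℕ) : ℤ)) * 1 :=
          mul_le_mul hj (hg m) (norm_nonneg _) (by positivity)
      _ ≤ (2 : ℝ) ^ (-((n + 1 : ℕ) : ℤ)) := by rw [mul_one]; exact two_zpow_antitone hle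
  · -- odd index: `m^{2^{n+1}-1} - m⁻¹ = m⁻¹ (m^{2^{n+1}} - 1)`, `‖·‖ ≤ 2^{-(n+2)} ≤ 2^{-(n+1)}`
    rw [if_pos hm, ← sub_mul, norm_mul]
    have hsc : (m : L) ^ (2 ^ (n + 1) - 1) - (m : L)⁻¹ =
        algebraMap ℚ_[2] L ((m : ℚ_[2]) ^ (2 ^ (n + 1) - 1) - (m : ℚ_[2])⁻¹) := by
      simp [map_natCast]
    have hj : ‖(m : L) ^ (2 ^ (n + 1) - 1) - (m : L)⁻¹‖ ≤ (2 : ℝ) ^ (-((n + 2 : ℕ) : ℤ)) := by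
      rw [hsc, norm_algebraMap']
      exact norm_pow_sub_inv_le hm (n + 1)
    calc ‖(m : L) ^ (2 ^ (n + 1) - 1) - (m : L)⁻¹‖ * ‖g m‖
        ≤ (2 : ℝ) ^ (-((n + 2 : ℕ) : ℤ)) * 1 :=
          mul_le_mul hj (hg m) (norm_nonneg _) (by positivity)
      _ ≤ (2 : ℝ) ^ (-((n + 1 : ℕ) : ℤ)) := by
          rw [mul_one]; exact two_zpow_antitone (by push_cast; omega)

/-- **Depletion is invisible in the limit (PROVED):** `‖θ^j g (m) − θ^j g^♭ (m)‖ ≤ 2^{−j}`, so the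
UNDEPLETED in-range objects `θ^{j_n} f₀` (HB3, classical comparison, no `V`) have the same limit. -/
theorem norm_thetaPow_sub_depl_le (g : ℕ → L) (hg : ∀ m, ‖g m‖ ≤ 1) (j m : ℕ) :
    ‖thetaPow j g m - thetaPow j (depl g) m‖ ≤ (2 : ℝ) ^ (-(j : ℤ)) := by
  unfold thetaPow depl
  rcases Nat.even_or_odd m with hm | hm
  · rw [if_neg (Nat.not_odd_iff_even.mpr hm), mul_zero, sub_zero, norm_mul]
    have hj : ‖(m : L) ^ j‖ ≤ (2 : ℝ) ^ (-(j : ℤ)) := by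
      rw [norm_pow, norm_natCast_algebra, ← norm_pow]
      exact norm_pow_le_of_even hm _
    calc ‖(m : L) ^ j‖ * ‖g m‖ ≤ (2 : ℝ) ^ (-(j : ℤ)) * 1 :=
          mul_le_mul hj (hg m) (norm_nonneg _) (by positivity)
      _ = (2 : ℝ) ^ (-(j : ℤ)) := mul_one _
  · rw [if_pos hm, sub_self, norm_zero]; positivity

/-- **HB2 interface (PRINT, every `p`):** an evaluation functional that is a CONTRACTION for the
coefficientwise sup-distance ON a designated set `M` of q-expansions (`M` = q-expansions at `∞` of
`(V(N₀) ⊗̂ 𝒪_{ℂ₂})[½]`, Katz's generalised 2-adic modular functions) — Katz: q-expansion principle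
for every `W`-algebra `A` (⟹ saturation `F(q) ≡ 0 mod ϖ^r ⟹ F ∈ ϖ^r·V⊗A`) + evaluation at a
trivialised ordinary test object over `𝒪_{ℂ₂}` = base change.  Stated ON `M` only: `ℂ₂` is not
spherically complete, so no Lipschitz extension to all of `ℕ → L` is claimed. -/
def IsQExpContractionOn (M : Set (ℕ → L)) (ev : (ℕ → L) → L) : Prop :=
  ∀ F ∈ M, ∀ G ∈ M, ∀ r : ℝ, (∀ m, ‖F m - G m‖ ≤ r) → ‖ev F - ev G‖ ≤ r

theorem tendsto_two_zpow_neg_succ : Tendsto (fun n : ℕ => (2 : ℝ) ^ (-((n + 1 : ℕ) : ℤ))) atTop (𝓝 0) := by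
  have h : (fun n : ℕ => (2 : ℝ) ^ (-((n + 1 : ℕ) : ℤ))) = fun n => ((2 : ℝ)⁻¹) ^ (n + 1) := by
    funext n; rw [zpow_neg, zpow_natCast, inv_pow]
  rw [h]
  exact (tendsto_pow_atTop_nhds_zero_of_lt_one (by norm_num) (by norm_num)).comp
    (tendsto_add_atTop_nat 1)

/-- **GLUE (PROVED): HB1 ∧ HB2 ⟹ the value of `θ^{2^{n+1}−1} f₀` at a FIXED trivialised ordinary test
object tends to the value of `θ^{−1} f₀^♭` there.**  No Serre–Tate coordinate, no measure, no torsion. -/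
theorem tendsto_ev_thetaPow {M : Set (ℕ → L)} {ev : (ℕ → L) → L} (hev : IsQExpContractionOn M ev)
    (g : ℕ → L) (hg : ∀ m, ‖g m‖ ≤ 1) (hM : ∀ j, thetaPow j g ∈ M) (hM' : thetaInvDepl g ∈ M) :
    Tendsto (fun n => ev (thetaPow (2 ^ (n + 1) - 1) g)) atTop (𝓝 (ev (thetaInvDepl g))) := by
  rw [tendsto_iff_norm_sub_tendsto_zero]
  refine squeeze_zero (fun n => norm_nonneg _) (fun n => ?_) tendsto_two_zpow_neg_succ
  exact hev _ (hM _) _ hM' _ (fun m => norm_thetaPow_sub_thetaInvDepl_le g hg n m)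

/-! ### §4. The BDP-side carrier as a record of DELIVERABLES (no `∃`) and H_B's `limS` (PROVED) -/

/-- HB2 + HB2′ deliverables for ONE key: `ι` = the finite set `Pic 𝒪_{c₀2^{n_v}}` of trivialised
ordinary CM test objects `x_𝔞` on `X(N₀, ε₀)` over `𝒪_{ℂ₂}`; `ev a` = evaluation at `x_𝔞` (HB2:
contraction); `g` = q-expansion of `f₀` (algebraic integers); `c n a` = the level-`n` weight
`(χ⋆Λ^{2^{n+1}})⁻¹(𝔞)·N𝔞^{1−2^{n+1}}·(trivialisation ratio)`, `cstar a` its limit (HB2′). -/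
structure CMEvaluationData (L : Type*) [NormedField L] [NormedAlgebra ℚ_[2] L] (ι : Type*)
    [Fintype ι] where
  /-- q-expansions at `∞` of `(V(N₀, ε₀) ⊗̂ 𝒪_{ℂ₂})[½]` (the domain of the evaluations) -/
  M : Set (ℕ → L)
  /-- evaluation at the `a`-th trivialised ordinary CM test object -/
  ev : ι → (ℕ → L) → L
  /-- HB2 (print, every `p`): q-expansion principle + base change -/
  contraction : ∀ a, IsQExpContractionOn M (ev a)
  /-- q-expansion of the good partner's newform `f₀` (a classical, hence 2-adic, cusp form) -/
  g : ℕ → L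
  g_le : ∀ m, ‖g m‖ ≤ 1
  /-- `θ^j f₀ ∈ V ⊗̂ 𝒪_{ℂ₂}` (`θ` acts on `V`, Katz) and `θ^{−1} f₀^♭ ∈ V ⊗̂ 𝒪_{ℂ₂}` (its q-adic limit;
  `V ⊗̂ 𝒪_{ℂ₂}` is complete and saturated) -/
  mem_thetaPow : ∀ j, thetaPow j g ∈ M
  mem_thetaInvDepl : thetaInvDepl g ∈ M
  /-- level-`n` character weights and their limits (HB2′) -/
  c : ℕ → ι → L
  cstar : ι → L
  c_tendsto : ∀ a, Tendsto (fun n => c n a) atTop (𝓝 (cstar a))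

variable {ι : Type*} [Fintype ι]

/-- the BDP-side in-range sum at weight `j_n = 2^{n+1} − 1` (UNDEPLETED `θ^{j_n} f₀`, HB3's object) -/
def CMEvaluationData.S (D : CMEvaluationData L ι) (n : ℕ) : L :=
  ∑ a, D.c n a * D.ev a (thetaPow (2 ^ (n + 1) - 1) D.g)

/-- the BDP-side limit `S⋆ = Σ c⋆(𝔞)·(θ^{−1} f₀^♭)(x_𝔞)` (k1-g6's `Sstar`) -/
def CMEvaluationData.Sstar (D : CMEvaluationData L ι) : L :=
  ∑ a, D.cstar a * D.ev a (thetaInvDepl D.g)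

/-- **H_B(limit) from the split (PROVED):** exactly the type of k1-g6's field
`OddCosetWitness.limS : Tendsto S atTop (𝓝 Sstar)`. -/
theorem CMEvaluationData.limS (D : CMEvaluationData L ι) : Tendsto D.S atTop (𝓝 D.Sstar) := by
  unfold CMEvaluationData.S CMEvaluationData.Sstar
  exact tendsto_finsetSum _
    (fun a _ => (D.c_tendsto a).mul
      (tendsto_ev_thetaPow (D.contraction a) D.g D.g_le D.mem_thetaPow D.mem_thetaInvDepl))

/-- HB2′ atom 1 (PROVED): `N^{2^{n}} → 1` in `L` for odd `N` (norms of ideals prime to 2). -/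
theorem tendsto_natCast_pow_two_pow {N : ℕ} (hN : Odd N) :
    Tendsto (fun n : ℕ => (N : L) ^ (2 ^ (n + 1))) atTop (𝓝 1) := by
  rw [tendsto_iff_norm_sub_tendsto_zero]
  refine squeeze_zero (fun n => norm_nonneg _) (fun n => ?_) tendsto_two_zpow_neg_succ
  have hsc : (N : L) ^ (2 ^ (n + 1)) - 1 = algebraMap ℚ_[2] L ((N : ℚ_[2]) ^ (2 ^ (n + 1)) - 1) := by
    simp [map_natCast]
  rw [hsc, norm_algebraMap']
  exact (norm_pow_two_pow_sub_one_le hN (n + 1)).trans (two_zpow_antitone (by push_cast; omega))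

/-- HB2′ atom 2 (PROVED): `u^{2^{n}} → 1` in `L` for a 2-adic unit `u` (values `Λ(𝔞) ∈ ℤ₂^×`). -/
theorem tendsto_unit_pow_two_pow {u : ℤ_[2]} (hu : IsUnit u) :
    Tendsto (fun n : ℕ => (algebraMap ℚ_[2] L (u : ℚ_[2])) ^ (2 ^ (n + 1))) atTop (𝓝 1) := by
  rw [tendsto_iff_norm_sub_tendsto_zero]
  refine squeeze_zero (fun n => norm_nonneg _) (fun n => ?_) tendsto_two_zpow_neg_succ
  have hsc : (algebraMap ℚ_[2] L (u : ℚ_[2])) ^ (2 ^ (n + 1)) - 1 =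
      algebraMap ℚ_[2] L (((u ^ (2 ^ (n + 1)) - 1 : ℤ_[2]) : ℚ_[2])) := by
    simp
  rw [hsc, norm_algebraMap', ← PadicInt.norm_def]
  exact (norm_unit_pow_two_pow_sub_one_le hu (n + 1)).trans (two_zpow_antitone (by push_cast; omega))

omit [NormedAlgebra ℚ_[2] L] in
/-- HB2′ atom 3 (PROVED): the finite-order part — a root of unity of 2-power order (values of the
fixed ring-class character and of `Λ`'s finite part, conductor `2^∞`) is EVENTUALLY killed. -/
theorem tendsto_pow_two_pow_of_pow_eq_one {ζ : L} {a : ℕ} (hζ : ζ ^ (2 ^ a) = 1) :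
    Tendsto (fun n : ℕ => ζ ^ (2 ^ (n + a))) atTop (𝓝 1) := by
  have h : (fun n : ℕ => ζ ^ (2 ^ (n + a))) = fun _ => 1 := by
    funext n; rw [pow_add, mul_comm, pow_mul, hζ, one_pow]
  rw [h]; exact tendsto_const_nhds

/-- The card's instantiation `L = ℂ₂` type-checks (Mathlib's `PadicComplex`). -/
example : NormedAlgebra ℚ_[2] ℂ_[2] := inferInstance

/-! ### §5. Lemma V (gift to H_C): the canonical subgroup of a CM curve of conductor `c·2^{k+1}` at the
SPLIT prime 2 is the kernel of the UP-isogeny — as a LATTICE computation (PROVED)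

Dictionary: `ℤ² ↔ 𝒪_{K₀} ⊗ ℤ₍₂₎ = ℤ₍₂₎(v) × ℤ₍₂₎(v̄)`; `inOrder k (a,b) ↔ (a,b) ∈ 𝒪_{c2^k} ⊗ ℤ₍₂₎`
(`a ≡ b mod 2^k`; the prime-to-2 conductor `c` is invisible at 2); the connected `ℤ₂`-line of the
ordinary CM 2-divisible group is a `K₀ ⊗ ℚ₂`-eigenline (Serre–Tate), say `{(a,0)}`:
(V1) `T⁰ = 𝒪_{c2^{k+1}} ∩ line = 2^{k+1}·e_v`, so `C_can = ⟨(2^k, 0)⟩ mod lattice`;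
(V2) `𝒪_{c2^{k+1}} + ℤ·(2^k,0) = 𝒪_{c2^k}`: the quotient by `C_can` goes UP one level;
(V3) the other two order-2 subgroups give `½·𝒪_{c2^{k+2}}`: DOWN (CH18 §4.4's `p + 1 = 2 + 1`
sublattices, Case (i)/(ii), at `p = 2`). -/

/-- membership in the conductor-`2^k` order, in `(v, v̄)`-coordinates -/
def inOrder (k : ℕ) (a b : ℤ) : Prop := (2 : ℤ) ^ k ∣ a - b

/-- (V1) the connected line meets `𝒪_{2^k}` in `2^k ℤ·e_v`. -/
theorem inOrder_line_iff (k : ℕ) (a : ℤ) : inOrder k a 0 ↔ (2 : ℤ) ^ k ∣ a := by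
  simp [inOrder]

/-- (V2) UP: `𝒪_{2^{k+1}} + ℤ·(2^k, 0) = 𝒪_{2^k}` — the quotient by the canonical subgroup
`⟨(2^k,0)⟩` of `ℂ/𝒪_{2^{k+1}}` is `ℂ/𝒪_{2^k}`. -/
theorem inOrder_iff_exists_up (k : ℕ) (a b : ℤ) :
    inOrder k a b ↔ ∃ a' t : ℤ, inOrder (k + 1) a' b ∧ a = a' + t * 2 ^ k := by
  unfold inOrder
  constructor
  · rintro ⟨s, hs⟩
    rcases Int.even_or_odd s with ⟨r, hr⟩ | ⟨r, hr⟩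
    · exact ⟨a, 0, ⟨r, by linear_combination hs + 2 ^ k * hr⟩, by ring⟩
    · exact ⟨a - 2 ^ k, 1, ⟨r, by linear_combination hs + 2 ^ k * hr⟩, by ring⟩
  · rintro ⟨a', t, ⟨u, hu⟩, ha⟩
    exact ⟨2 * u + t, by linear_combination ha + hu⟩

/-- (V3) DOWN: `2·(𝒪_{2^{k+1}} + ℤ·(½,½)) = 𝒪_{2^{k+2}}` — the quotient by the order-2 subgroup
`⟨(½,½)⟩` is (homothetic to) `ℂ/𝒪_{2^{k+2}}`, one level DOWN; idem for `⟨(½ + 2^k, ½)⟩` by (V2)∘(V3). -/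
theorem inOrder_succ_succ_iff_exists_down (k : ℕ) (x y : ℤ) :
    inOrder (k + 2) x y ↔ ∃ a b t : ℤ, inOrder (k + 1) a b ∧ x = 2 * a + t ∧ y = 2 * b + t := by
  unfold inOrder
  constructor
  · rintro ⟨s, hs⟩
    rcases Int.even_or_odd x with ⟨r, hr⟩ | ⟨r, hr⟩
    · refine ⟨r, r - 2 ^ (k + 1) * s, 0, ⟨s, by ring⟩, by linear_combination hr, ?_⟩
      linear_combination hr - hs
    · refine ⟨r, r - 2 ^ (k + 1) * s, 1, ⟨s, by ring⟩, by linear_combination hr, ?_⟩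
      linear_combination hr - hs
  · rintro ⟨a, b, t, ⟨u, hu⟩, hx, hy⟩
    exact ⟨u, by linear_combination hx - hy + 2 * hu⟩

/-- (V3′) DOWN for the third order-2 subgroup `⟨(½ + 2^k, ½)⟩`:
`2·(𝒪_{2^{k+1}} + ℤ·(½+2^k, ½)) = (1 + 2^{k+1}, 1)·𝒪_{2^{k+2}}` — so of the `2 + 1` isogenies of
degree 2 out of conductor `2^{k+1}` EXACTLY ONE (the canonical one, V1/V2) raises the level, the
other two lower it (the 2-isogeny volcano at a split prime, by hand). -/
theorem inOrder_succ_succ_iff_exists_down' (k : ℕ) (x y : ℤ) :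
    inOrder (k + 2) x y ↔
      ∃ a b t : ℤ, inOrder (k + 1) a b ∧ (1 + 2 ^ (k + 1)) * x = 2 * a + t * (1 + 2 ^ (k + 1)) ∧
        y = 2 * b + t := by
  unfold inOrder
  constructor
  · rintro ⟨s, hs⟩
    rcases Int.even_or_odd y with ⟨r, hr⟩ | ⟨r, hr⟩
    · refine ⟨(1 + 2 ^ (k + 1)) * (r + 2 ^ (k + 1) * s), r, 0,
        ⟨r + s + 2 ^ (k + 1) * s, by ring⟩, by linear_combination (1 + 2 ^ (k + 1)) * (hs + hr),
        by linear_combination hr⟩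
    · refine ⟨(1 + 2 ^ (k + 1)) * (r + 2 ^ (k + 1) * s), r, 1,
        ⟨r + s + 2 ^ (k + 1) * s, by ring⟩, by linear_combination (1 + 2 ^ (k + 1)) * (hs + hr),
        by linear_combination hr⟩
  · rintro ⟨a, b, t, ⟨u, hu⟩, hx, hy⟩
    have hcop : IsCoprime ((2 : ℤ) ^ (k + 2)) (1 + 2 ^ (k + 1)) := by
      have h2 : IsCoprime (2 : ℤ) (1 + 2 ^ (k + 1)) := ⟨-(2 ^ k), 1, by ring⟩
      exact h2.pow_left
    have hmul : (2 : ℤ) ^ (k + 2) ∣ (1 + 2 ^ (k + 1)) * (x - y) :=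
      ⟨u - b, by linear_combination hx - (1 + 2 ^ (k + 1)) * hy + 2 * hu⟩
    exact hcop.dvd_of_dvd_mul_left hmul

end Summit.BirchSwinnertonDyer.BirchSwinnertonDyer.Cruxes.SplitBadTwoLowerHalfOfFacts.HeegnerIndexTwo.K3G7
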